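import Literature.AnabelianGeometry.AbsoluteAnabelian.AbsTopIII.LinearSystems
import Literature.AnabelianGeometry.AbsoluteAnabelian.AbsTopIII.LinearSystemsValuesProofs
import Literature.NumberTheory.DiophantineGeometry.FunctionFieldGenusRatPlacesProofs
import HarnessLib

/-!
# [AbsTopIII] Prop. 1.2 (iii): the relation "`g(y) = f(y)`" (`SameValueAt`) — kernel record of the
# predicate (FACT-LIST row F-0387)

Mochizuki, *Topics in Absolute Anabelian Geometry III*, §1, Proposition 1.2 (iii), p. 30 of the
author's manuscript (lit key `paper:url-5493eb38cbb7`): "`f_{λ,1} + f_{μ,2} ∈ Γ^×(D)` may be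
characterized as the unique element `g ∈ Γ^×(D)` such that `g(y₁) = f_{λ,1}(y₁)`,
`g(y₂) = f_{μ,2}(y₂)`".  The trunk file `AbsTopIII/LinearSystems.lean` (abc-iut-L4-t1, p403944 /
p404492) types the relation "`g(y) = f(y)`" at a point `y` (= a place `v` of the function field
`K/k`) as the PREDICATE

  `SameValueAt v f g : Prop := v.valuation (f - g) < 1`

(both values taken in the residue field `k(v)`; for `f, g ∈ 𝒪_v` this is literally
`f ≡ g (mod 𝔪_v)`).

PROOF-ONLY companion (abc-iut cell, F fact-proving wave, seat abc-iut-f-086; row F-0387 of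
plan/FACT-LIST.md, `kernel_closedness = parametrised`).  `SameValueAt` is VOCABULARY, not a claim:
it has free parameters `v, f, g`, and its universal closure is FALSE — at every place `v` one has
`¬ SameValueAt v 1 0` (`v(1) = 1`), see `SameValueAt.not_one_zero` and `not_forall_sameValueAt`
(instance: the place `P_0 = P_X` of `ℝ(X)/ℝ`, `AlgFunctionField.placeXSubC`).  What this file
records in the kernel instead:

* `SameValueAt v` is an EQUIVALENCE RELATION on `K` (ultrametric inequality) compatible with
  addition, negation, and with multiplication by `v`-integral elements (`SameValueAt.refl/symm/
  trans/add/neg/sub/mul`), and it preserves `v`-integrality (`valuation_le_one_iff`);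
* its link with the trunk's "`f(x) = λ`" (`HasValue v f a := v(f − a) < 1`):
  `HasValue v f a ↔ SameValueAt v f (algebraMap k K a)` (definitional), hence two functions with
  the same value `a` at `v` are `SameValueAt`, and `SameValueAt` transports values
  (`HasValue.sameValueAt`, `SameValueAt.hasValue_iff`);
* the instance form in which Prop. 1.2 (iii) consumes it: "`g(y₁) = f_{λ,1}(y₁)`" for
  `g = f_{λ,1} + f_{μ,2}` is exactly "`f_{μ,2}(y₁) = 0`" (`sameValueAt_add_left_iff_hasValue_zero`);
* distinct constants are never `SameValueAt` (`not_sameValueAt_algebraMap`), the universal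
  closure is refuted (`not_forall_sameValueAt`), and the relation is non-vacuous (`refl`).

The only consumer of `SameValueAt` in the tree, the named fact `Prop_1_2_iii`, is already
DISCHARGED (`Prop_1_2_iii_holds`, `LinearSystemsProp12Proofs.lean`, p405103); nothing here restates
it.  Classical valuation calculus; nothing in this file bears on [IUTchIII] Cor. 3.12.
-/

noncomputable section

namespace Literature.AnabelianGeometry.AbsoluteAnabelian.AbsTopIII

open Literature.NumberTheory.DiophantineGeometry
open Literature.NumberTheory.DiophantineGeometry.AlgFunctionField

universe u v

variable {k : Type u} {K : Type v} [Field k] [Field K] [Algebra k K]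

namespace SameValueAt

/-- Unfolding: "`g(y) = f(y)`" means `v(f − g) < 1`. [cite: MochizukiAbsTopIII2015, Prop 1.2 (iii) p.30] -/
theorem iff_valuation_sub_lt_one (v : PlaceOver k K) (f g : K) :
    SameValueAt v f g ↔ v.valuation (f - g) < 1 :=
  Iff.rfl

/-- "`f(y) = f(y)`": the relation is reflexive (non-vacuity of the predicate).
[cite: MochizukiAbsTopIII2015, Prop 1.2 (iii) p.30] -/
protected theorem refl (v : PlaceOver k K) (f : K) : SameValueAt v f f := by
  change v.valuation (f - f) < 1
  rw [sub_self, Valuation.map_zero]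
  exact zero_lt_one

/-- The relation "`g(y) = f(y)`" is symmetric (`v(g − f) = v(f − g)`).
[cite: MochizukiAbsTopIII2015, Prop 1.2 (iii) p.30] -/
protected theorem symm {v : PlaceOver k K} {f g : K} (h : SameValueAt v f g) : SameValueAt v g f := by
  change v.valuation (g - f) < 1
  rw [Valuation.map_sub_swap]
  exact h

/-- The relation "`g(y) = f(y)`" is transitive (ultrametric inequality).
[cite: MochizukiAbsTopIII2015, Prop 1.2 (iii) p.30] -/
protected theorem trans {v : PlaceOver k K} {f g h : K} (hfg : SameValueAt v f g)
    (hgh : SameValueAt v g h) : SameValueAt v f h := by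
  change v.valuation (f - h) < 1
  have e : f - h = (f - g) + (g - h) := by ring
  rw [e]
  exact Valuation.map_add_lt _ hfg hgh

/-- Symmetry as an `iff`. [cite: MochizukiAbsTopIII2015, Prop 1.2 (iii) p.30] -/
theorem comm {v : PlaceOver k K} {f g : K} : SameValueAt v f g ↔ SameValueAt v g f :=
  ⟨SameValueAt.symm, SameValueAt.symm⟩

/-- "Having the same value at `y`" is an equivalence relation on `K_X`.
[cite: MochizukiAbsTopIII2015, Prop 1.2 (iii) p.30] -/
theorem equivalence (v : PlaceOver k K) : Equivalence (SameValueAt v) :=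
  ⟨SameValueAt.refl v, SameValueAt.symm, SameValueAt.trans⟩

/-- Compatibility with addition: `f(y) = g(y)`, `f'(y) = g'(y)` ⟹ `(f + f')(y) = (g + g')(y)`.
[cite: MochizukiAbsTopIII2015, Prop 1.2 (iii) p.30] -/
protected theorem add {v : PlaceOver k K} {f g f' g' : K} (h : SameValueAt v f g)
    (h' : SameValueAt v f' g') : SameValueAt v (f + f') (g + g') := by
  change v.valuation (f + f' - (g + g')) < 1
  have e : f + f' - (g + g') = (f - g) + (f' - g') := by ring
  rw [e]
  exact Valuation.map_add_lt _ h h'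

/-- Compatibility with negation. [cite: MochizukiAbsTopIII2015, Prop 1.2 (iii) p.30] -/
protected theorem neg {v : PlaceOver k K} {f g : K} (h : SameValueAt v f g) :
    SameValueAt v (-f) (-g) := by
  change v.valuation (-f - -g) < 1
  have e : -f - -g = g - f := by ring
  rw [e]
  exact SameValueAt.symm h

/-- Compatibility with subtraction. [cite: MochizukiAbsTopIII2015, Prop 1.2 (iii) p.30] -/
protected theorem sub {v : PlaceOver k K} {f g f' g' : K} (h : SameValueAt v f g)
    (h' : SameValueAt v f' g') : SameValueAt v (f - f') (g - g') := by
  rw [sub_eq_add_neg, sub_eq_add_neg]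
  exact SameValueAt.add h (SameValueAt.neg h')

/-- Compatibility with multiplication by `v`-INTEGRAL functions: if `f(y) = g(y)`, `f'(y) = g'(y)`
and `f', g ∈ 𝒪_y`, then `(f f')(y) = (g g')(y)` (for non-integral factors the relation
`v(f − g) < 1` is not multiplicative). [cite: MochizukiAbsTopIII2015, Prop 1.2 (iii) p.30] -/
protected theorem mul {v : PlaceOver k K} {f g f' g' : K} (h : SameValueAt v f g)
    (h' : SameValueAt v f' g') (hf' : v.valuation f' ≤ 1) (hg : v.valuation g ≤ 1) :
    SameValueAt v (f * f') (g * g') := by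
  change v.valuation (f * f' - g * g') < 1
  have e : f * f' - g * g' = (f - g) * f' + g * (f' - g') := by ring
  rw [e]
  refine Valuation.map_add_lt _ ?_ ?_
  · rw [Valuation.map_mul]
    calc v.valuation (f - g) * v.valuation f'
        ≤ v.valuation (f - g) * 1 := mul_le_mul' le_rfl hf'
      _ = v.valuation (f - g) := mul_one _
      _ < 1 := h
  · rw [Valuation.map_mul]
    calc v.valuation g * v.valuation (f' - g')
        ≤ 1 * v.valuation (f' - g') := mul_le_mul' hg le_rfl
      _ = v.valuation (f' - g') := one_mul _
      _ < 1 := h'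

/-- `SameValueAt` preserves `v`-integrality: if `f(y) = g(y)` then `f ∈ 𝒪_y ↔ g ∈ 𝒪_y`.
[cite: MochizukiAbsTopIII2015, Prop 1.2 (iii) p.30] -/
theorem valuation_le_one_iff {v : PlaceOver k K} {f g : K} (h : SameValueAt v f g) :
    v.valuation f ≤ 1 ↔ v.valuation g ≤ 1 := by
  have key : ∀ {a b : K}, SameValueAt v a b → v.valuation b ≤ 1 → v.valuation a ≤ 1 := by
    intro a b hab hb
    have e : a = (a - b) + b := by ring
    rw [e]
    exact (Valuation.map_add _ _ _).trans (max_le hab.le hb)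
  exact ⟨key (SameValueAt.symm h), key h⟩

/-- "`g(y) = 0`": `SameValueAt v g 0 ↔ v(g) < 1` (i.e. `g ∈ 𝔪_y`).
[cite: MochizukiAbsTopIII2015, Prop 1.2 (iii) p.30] -/
theorem zero_right_iff (v : PlaceOver k K) (g : K) : SameValueAt v g 0 ↔ v.valuation g < 1 := by
  rw [iff_valuation_sub_lt_one, sub_zero]

/-- At EVERY place the universal closure of the predicate fails: `1(y) ≠ 0(y)` (`v(1 − 0) = 1`).
[cite: MochizukiAbsTopIII2015, Prop 1.2 (iii) p.30] -/
theorem not_one_zero (v : PlaceOver k K) : ¬ SameValueAt v 1 0 := by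
  rw [zero_right_iff, Valuation.map_one]
  exact lt_irrefl 1

/-- Hence at every place there are functions with different values.
[cite: MochizukiAbsTopIII2015, Prop 1.2 (iii) p.30] -/
theorem exists_not (v : PlaceOver k K) : ∃ f g : K, ¬ SameValueAt v f g :=
  ⟨1, 0, not_one_zero v⟩

end SameValueAt

/-! ### Link with "`f(x) = λ`" (`HasValue`) -/

/-- "`f(x) = λ`" is "`f(x) = c_λ(x)`" for the constant function `c_λ = λ ∈ k ⊆ K_X` (definitional).
[cite: MochizukiAbsTopIII2015, Prop 1.2 (ii) p.29] -/
theorem hasValue_iff_sameValueAt_algebraMap (v : PlaceOver k K) (f : K) (a : k) :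
    HasValue v f a ↔ SameValueAt v f (algebraMap k K a) :=
  Iff.rfl

/-- "`f(x) = 0`" is `SameValueAt v f 0`. [cite: MochizukiAbsTopIII2015, Prop 1.2 (ii) p.29] -/
theorem hasValue_zero_iff_sameValueAt_zero (v : PlaceOver k K) (f : K) :
    HasValue v f 0 ↔ SameValueAt v f 0 := by
  rw [hasValue_iff_sameValueAt_algebraMap, map_zero]

/-- Two functions with the same value `λ` at `x` have "the same value at `x`".
[cite: MochizukiAbsTopIII2015, Prop 1.2 (iii) p.30] -/
theorem HasValue.sameValueAt {v : PlaceOver k K} {f g : K} {a : k} (hf : HasValue v f a)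
    (hg : HasValue v g a) : SameValueAt v f g :=
  SameValueAt.trans hf (SameValueAt.symm hg)

/-- `SameValueAt` transports values: if `f(x) = g(x)` and `g(x) = λ` then `f(x) = λ`.
[cite: MochizukiAbsTopIII2015, Prop 1.2 (iii) p.30] -/
theorem SameValueAt.hasValue {v : PlaceOver k K} {f g : K} {a : k} (hfg : SameValueAt v f g)
    (hg : HasValue v g a) : HasValue v f a :=
  SameValueAt.trans hfg hg

/-- If `f(x) = g(x)` then `f` and `g` have the same values at `x`: `f(x) = λ ↔ g(x) = λ`.
[cite: MochizukiAbsTopIII2015, Prop 1.2 (iii) p.30] -/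
theorem SameValueAt.hasValue_iff {v : PlaceOver k K} {f g : K} (hfg : SameValueAt v f g) (a : k) :
    HasValue v f a ↔ HasValue v g a :=
  ⟨fun hf => (SameValueAt.symm hfg).hasValue hf, fun hg => hfg.hasValue hg⟩

/-- "`g(y) = f(y)`" when `f(y) = λ` is known: `SameValueAt v g f ↔ g(y) = λ`.
[cite: MochizukiAbsTopIII2015, Prop 1.2 (iii) p.30] -/
theorem sameValueAt_iff_hasValue_of_hasValue {v : PlaceOver k K} {f : K} {a : k} (hf : HasValue v f a)
    (g : K) : SameValueAt v g f ↔ HasValue v g a :=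
  ⟨fun h => h.hasValue hf, fun hg => hg.sameValueAt hf⟩

/-- The instance form consumed by Prop. 1.2 (iii): for `g = f₁ + f₂`, "`g(y₁) = f₁(y₁)`" is exactly
"`f₂(y₁) = 0`" (`(f₁ + f₂) − f₁ = f₂`). [cite: MochizukiAbsTopIII2015, Prop 1.2 (iii) p.30] -/
theorem sameValueAt_add_left_iff_hasValue_zero (v : PlaceOver k K) (f₁ f₂ : K) :
    SameValueAt v (f₁ + f₂) f₁ ↔ HasValue v f₂ 0 := by
  rw [hasValue_zero_iff_sameValueAt_zero, SameValueAt.iff_valuation_sub_lt_one,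
    SameValueAt.zero_right_iff, add_sub_cancel_left]

/-- Symmetric instance form: for `g = f₁ + f₂`, "`g(y₂) = f₂(y₂)`" is exactly "`f₁(y₂) = 0`".
[cite: MochizukiAbsTopIII2015, Prop 1.2 (iii) p.30] -/
theorem sameValueAt_add_right_iff_hasValue_zero (v : PlaceOver k K) (f₁ f₂ : K) :
    SameValueAt v (f₁ + f₂) f₂ ↔ HasValue v f₁ 0 := by
  rw [add_comm]
  exact sameValueAt_add_left_iff_hasValue_zero v f₂ f₁

/-- Distinct constants `λ ≠ μ` never have the same value at a point (`v(λ − μ) = 1` since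
`λ − μ ∈ k^×`). [cite: MochizukiAbsTopIII2015, Prop 1.2 (iii) p.30] -/
theorem not_sameValueAt_algebraMap (v : PlaceOver k K) {a b : k} (hab : a ≠ b) :
    ¬ SameValueAt v (algebraMap k K a) (algebraMap k K b) := by
  rw [SameValueAt.iff_valuation_sub_lt_one, ← map_sub,
    valuation_algebraMap_eq_one_of_ne_zero v (sub_ne_zero.mpr hab)]
  exact lt_irrefl 1

/-- If `f(x) = g(x)`, `f(x) = λ` and `g(x) = μ` then `λ = μ` (values are unique,
`HasValue.unique` of `LinearSystemsValuesProofs`, transported along `SameValueAt`).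
[cite: MochizukiAbsTopIII2015, Prop 1.2 (iii) p.30] -/
theorem SameValueAt.eq_of_hasValue {v : PlaceOver k K} {f g : K} {a b : k} (hfg : SameValueAt v f g)
    (ha : HasValue v f a) (hb : HasValue v g b) : a = b :=
  HasValue.unique ha (hfg.hasValue hb)

/-! ### The universal closure of the predicate is false (FACT-LIST R1: schema, not a fact) -/

/-- **The universal closure of `SameValueAt` is REFUTED**: it fails for `f = 1`, `g = 0` at the
place `P_0 = P_X` of the rational function field `ℝ(X)/ℝ` (any place of any function field would
do, `SameValueAt.not_one_zero`; `ℝ` rather than `ℚ` only to avoid the two `ℚ`-algebra instances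
on `ℚ(X)`).  So F-0387 is a per-instance relation, never a hypothesis
`∀ v f g, SameValueAt v f g`. [cite: MochizukiAbsTopIII2015, Prop 1.2 (iii) p.30] -/
theorem not_forall_sameValueAt :
    ¬ ∀ (k K : Type) [Field k] [Field K] [Algebra k K] (v : PlaceOver k K) (f g : K),
        SameValueAt v f g :=
  fun h => SameValueAt.not_one_zero (placeXSubC (0 : ℝ)) (h ℝ (RatFunc ℝ) (placeXSubC (0 : ℝ)) 1 0)

/-- … while the predicate is satisfiable at that same place (`f = g`): the row is a genuine
two-sided schema. [cite: MochizukiAbsTopIII2015, Prop 1.2 (iii) p.30] -/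
theorem exists_sameValueAt_and_exists_not :
    ∃ (v : PlaceOver ℝ (RatFunc ℝ)), (∃ f g : RatFunc ℝ, SameValueAt v f g) ∧
      ∃ f g : RatFunc ℝ, ¬ SameValueAt v f g :=
  ⟨placeXSubC 0, ⟨1, 1, SameValueAt.refl _ 1⟩, SameValueAt.exists_not _⟩

end Literature.AnabelianGeometry.AbsoluteAnabelian.AbsTopIII
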